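import Literature.AnabelianGeometry.EtaleTheta.ThetaTrivializationsToy
import HarnessLib

/-!
# [EtTh] §1, Prop. 1.1 (i)/(ii) and Lem. 1.2 as FACT-LIST rows: kernel closure census of
# `Prop11i` (F-0654), `Prop11ii` (F-0655), `Lem12` (F-0653)

Mochizuki, *The étale theta function and its Frobenioid-theoretic manifestations*, Publ. RIMS **45**
(2009) [EtTh], §1, Prop. 1.1 (PRIMS PDF p. 15, printed 241) and Lem. 1.2 (p. 19, printed 245)
[cite: MochizukiEtTh2009, Prop 1.1 p.15].  abc-iut cell, D-0078 fact-proving wave, tranche 155 of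
`plan/F-TRANCHES.tsv` (seat abc-iut-w5-d095, gen 4); PROOF-ONLY companion of the statement file
`ThetaTrivializations.lean` (abc-iut-L2-t1) and of its toy producer `ThetaTrivializationsToy.lean`
(`LineBundleData.toy`, p422532).  No definition of the trunk file is edited or restated.

WHAT IS RECORDED IN THE KERNEL.  The three rows are `Prop`-valued predicates on the free-field data
interface `L : D.LineBundleData` (sections of `L_N`, `L̈_N`, the automorphism groups of the geometric
line bundles, the relations "compatible with the morphism determined by `s_N`", "is a theta
trivialization", …; formal schemes have no carrier in the tree).  Hence:

* for EVERY theta setting `D` there is ONE (junk, inline-built) line-bundle datum at which ALL THREE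
  predicates fail (`exists_lineBundleData_not_facts`): the `N`-th root of `s₁|_{Z_N}` exists only at
  `N = 1`, no action is "compatible", no section "is a theta trivialization";
* consequently the UNIVERSAL CLOSURES of F-0654 / F-0655 / F-0653 (over `p`, `D`, `L`) are FALSE
  (`not_forall_prop11i`, `not_forall_prop11ii`, `not_forall_lem12`), already over the root inhabitant
  `ThetaSetting.model 2` which satisfies the origin guard `IsEtThOrigin`
  (`exists_origin_lineBundleData_not_facts`);
* the instance forms are TOY-witnessed for every `D` (`LineBundleData.toy`, cited by name:
  `prop11i_toy`, `prop11ii_toy`, `lem12_toy`), so BOTH truth values occur over every setting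
  (`prop11i_independent_of_setting`, …): as typed, the content of Prop. 1.1 / Lem. 1.2 lives entirely in
  the datum `L`; the genuine instance is the formal-scheme model of `Y_N`, `Ÿ_N`, `L_N` (campaign-size,
  plan/FOUNDATIONS.md row 14), not a theorem over the present interface.

FACT-LIST reading (numbers, not opinions): F-0653/F-0654/F-0655 = «universal closure REFUTED; instance
form TOY-witnessed (p422532); hypothesis schema over `LineBundleData`».  Classical bookkeeping only;
nothing of [EtTh] is asserted or denied; no side is taken on [IUTchIII] Cor. 3.12; typed ≠ proved.
-/

noncomputable section

namespace Literature.AnabelianGeometry.EtaleTheta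

open Literature.AnabelianGeometry.SemiGraphs

namespace ThetaSetting

variable {p : ℕ} [Fact p.Prime] (D : ThetaSetting p)

/-! ### One junk datum violating all three predicates -/

/-- Over EVERY theta setting there is a line-bundle datum at which **Prop. 1.1 (i), Prop. 1.1 (ii) and
Lem. 1.2 all fail** — the junk datum `Γ(Z_N, L₁|_{Z_N}) := Bool`, `s₁|_{Z_N} := true`, `N`-th power map
constant `decide (N = 1)` (so an "`N`-th root of `s₁`" exists iff `N = 1`: (i) fails at `N = 2`), the
relation "compatible with the morphism determined by `s_N`" := `False` ((ii) fails at `N = 1`, where the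
root exists), "is a theta trivialization" := `False` (Lem. 1.2 fails), remaining fields as in
`LineBundleData.toy` (no definition is introduced; the datum is built inline).  As typed, the content
of the three rows lives in the datum `L`. [cite: MochizukiEtTh2009, Prop 1.1 p.15] -/
theorem exists_lineBundleData_not_facts :
    ∃ L : D.LineBundleData, ¬ Prop11i L ∧ ¬ Prop11ii L ∧ ¬ Lem12 L := by
  refine ⟨{ SecPow := fun _ => Bool
            Sec := fun _ => Unit
            powN := fun N _ => decide (N = 1)
            s₁res := fun _ => true
            AutV := fun N => D.PiTemp ⧸ D.GtpZN N
            instGroupAutV := fun N => @QuotientGroup.Quotient.group _ _ (D.GtpZN N) (D.GtpZN_normal N)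
            IsCompatibleWith := fun _ _ _ => False
            SecDd := fun _ => Unit
            IsThetaTriv := fun _ _ => False
            SecMix := fun _ _ _ => Unit
            powDd := fun _ _ _ _ => ()
            pullDd := fun _ _ _ _ => ()
            AutVdd := fun N => Multiplicative (ZMod (2 * N))
            Preserves := fun _ _ _ => True
            rootAct := fun _ => MonoidHom.id _
            rootAct_injective := fun _ => Function.injective_id
            AutCompat := fun _ _ _ _ _ => True
            actProp11 := fun _ => 1 }, ?_, ?_, ?_⟩
  · -- Prop. 1.1 (i): no square root of `s₁|_{Z_2}`
    intro h
    obtain ⟨_, hs⟩ := h 2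
    have hs' : decide ((2 : ℕ+) = 1) = true := hs
    exact absurd hs' (by decide)
  · -- Prop. 1.1 (ii): at `N = 1` the root exists, but no action is "compatible"
    intro h
    obtain ⟨_, hρ, -⟩ := h 1 () (show decide ((1 : ℕ+) = 1) = true by decide)
    exact hρ
  · -- Lem. 1.2: no theta trivialization at level 1
    rintro ⟨τ, hτ, -⟩
    exact hτ 1

/-- … already over a root inhabitant satisfying the origin guard `IsEtThOrigin` (abc-iut-L2-t1's
`ThetaSetting.model`): `∃ D L, D.IsEtThOrigin ∧ ¬ Prop11i L ∧ ¬ Prop11ii L ∧ ¬ Lem12 L`.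
[cite: MochizukiEtTh2009, Prop 1.1 p.15] -/
theorem exists_origin_lineBundleData_not_facts :
    ∃ (D' : ThetaSetting p) (L : D'.LineBundleData),
      D'.IsEtThOrigin ∧ ¬ Prop11i L ∧ ¬ Prop11ii L ∧ ¬ Lem12 L :=
  by
  obtain ⟨L, h⟩ := exists_lineBundleData_not_facts (ThetaSetting.model p)
  exact ⟨ThetaSetting.model p, L, ThetaSetting.model_isEtThOrigin p, h⟩

/-! ### F-0654 `Prop11i`: universal closure refuted; both truth values over every setting -/

/-- **F-0654 is a schema over `LineBundleData`: its universal closure is FALSE** (witness: the junk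
datum over `ThetaSetting.model 2`). [cite: MochizukiEtTh2009, Prop 1.1 (i) p.15] -/
theorem not_forall_prop11i :
    ¬ ∀ (p : ℕ) (_ : Fact p.Prime) (D : ThetaSetting p) (L : D.LineBundleData), Prop11i L :=
  fun h => by
  obtain ⟨L, h1, -, -⟩ := exists_lineBundleData_not_facts (p := 2) (ThetaSetting.model 2)
  exact h1 (h 2 Nat.fact_prime_two _ L)

/-- Over every theta setting `Prop11i` takes BOTH truth values as the datum varies (toy: true,
`prop11i_toy`; junk: false). [cite: MochizukiEtTh2009, Prop 1.1 (i) p.15] -/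
theorem prop11i_independent_of_setting :
    (∃ L : D.LineBundleData, Prop11i L) ∧ ∃ L : D.LineBundleData, ¬ Prop11i L :=
  ⟨⟨LineBundleData.toy D, prop11i_toy D⟩,
    let ⟨L, h1, _, _⟩ := exists_lineBundleData_not_facts D; ⟨L, h1⟩⟩

/-! ### F-0655 `Prop11ii`: universal closure refuted; both truth values over every setting -/

/-- **F-0655 is a schema over `LineBundleData`: its universal closure is FALSE** (witness: the junk
datum over `ThetaSetting.model 2`). [cite: MochizukiEtTh2009, Prop 1.1 (ii) p.15] -/
theorem not_forall_prop11ii :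
    ¬ ∀ (p : ℕ) (_ : Fact p.Prime) (D : ThetaSetting p) (L : D.LineBundleData), Prop11ii L :=
  fun h => by
  obtain ⟨L, -, h2, -⟩ := exists_lineBundleData_not_facts (p := 2) (ThetaSetting.model 2)
  exact h2 (h 2 Nat.fact_prime_two _ L)

/-- Over every theta setting `Prop11ii` takes BOTH truth values as the datum varies (toy: true,
`prop11ii_toy`; junk: false). [cite: MochizukiEtTh2009, Prop 1.1 (ii) p.15] -/
theorem prop11ii_independent_of_setting :
    (∃ L : D.LineBundleData, Prop11ii L) ∧ ∃ L : D.LineBundleData, ¬ Prop11ii L :=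
  ⟨⟨LineBundleData.toy D, prop11ii_toy D⟩,
    let ⟨L, _, h2, _⟩ := exists_lineBundleData_not_facts D; ⟨L, h2⟩⟩

/-! ### F-0653 `Lem12`: universal closure refuted; both truth values over every setting -/

/-- **F-0653 is a schema over `LineBundleData`: its universal closure is FALSE** (witness: the junk
datum over `ThetaSetting.model 2`). [cite: MochizukiEtTh2009, Lem 1.2 p.19] -/
theorem not_forall_lem12 :
    ¬ ∀ (p : ℕ) (_ : Fact p.Prime) (D : ThetaSetting p) (L : D.LineBundleData), Lem12 L :=
  fun h => by
  obtain ⟨L, -, -, h3⟩ := exists_lineBundleData_not_facts (p := 2) (ThetaSetting.model 2)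
  exact h3 (h 2 Nat.fact_prime_two _ L)

/-- Over every theta setting `Lem12` takes BOTH truth values as the datum varies (toy: true,
`lem12_toy`; junk: false). [cite: MochizukiEtTh2009, Lem 1.2 p.19] -/
theorem lem12_independent_of_setting :
    (∃ L : D.LineBundleData, Lem12 L) ∧ ∃ L : D.LineBundleData, ¬ Lem12 L :=
  ⟨⟨LineBundleData.toy D, lem12_toy D⟩,
    let ⟨L, _, _, h3⟩ := exists_lineBundleData_not_facts D; ⟨L, h3⟩⟩

/-- Summary for the three rows at once: the conjunction `Prop11i ∧ Prop11ii ∧ Lem12` is satisfiable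
(toy, p422532) and refutable (junk) over one and the same setting satisfying the origin guard — the
rows are hypothesis schemata over `LineBundleData`, neither theorems nor contradictions of the root
interface. [cite: MochizukiEtTh2009, Lem 1.2 p.19] -/
theorem lineBundleData_facts_both_ways :
    ∃ D' : ThetaSetting p, D'.IsEtThOrigin ∧
      (∃ L : D'.LineBundleData, Prop11i L ∧ Prop11ii L ∧ Lem12 L) ∧
      ∃ L : D'.LineBundleData, ¬ Prop11i L ∧ ¬ Prop11ii L ∧ ¬ Lem12 L :=
  ⟨ThetaSetting.model p, ThetaSetting.model_isEtThOrigin p, exists_lineBundleData_facts _,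
    exists_lineBundleData_not_facts _⟩

end ThetaSetting

end Literature.AnabelianGeometry.EtaleTheta

end
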